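import Summits.CriticalPhenomena.PercolationContinuityZ3.Theorems.PercNearOneGluingNoHeavyLowerTailDisjointPockets
import HarnessLib

/-!
# `NoHeavyLowerTail` (stmt-CriticalPhenomena-4575) — the LAMINAR THEOREM: a laminar family of pockets has total probability
# at most `t + 3·√P(o ↮ A)` (k-uniform; Kozma–Nitzan pair charging + van den Berg–Kahn)

Support file (lead gen 5; `--supports stmt-CriticalPhenomena-4575`).  No definitions, no named facts, no sorries.

Notation: `μ = prodBernoulli w` on `Fin n`, relays `A`, observer `o`, `π(o) = A.filter (o ↔ ·)`, pocket law `e(S) = μ{π(o) = S}`,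
`δ₀ = μ{o ↮ A}`, `t ≥ μ{a ↮ a'}` for all `a ≠ a' ∈ A`.  A family `F` of subsets of `A` is LAMINAR if any two members are nested or disjoint.

* `laminarPockets_sum_le` — **for every laminar family `F` of nonempty proper subsets of `A`:  `Σ_{S ∈ F} μ{π(o) = S} ≤ t + 3·√δ₀`.**
  Proof (LEAD-GEN5 §4): call `S ∈ F` HEAVY if the `F`-mass below it, `M(S) := Σ_{T ∈ F, T ⊆ S} e(T)`, exceeds `√δ₀`.  Two disjoint members cannot
  both be heavy (`M(S)·M(T) ≤ m(S)·m(T) ≤ δ₀`, van den Berg–Kahn via `pocketDF_mul_le_of_disjoint`), so the heavy members form a CHAIN and are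
  paid by ONE pair (`sum_pocketEq_le_notConn`): `≤ t`.  Heaviness is upward closed, so the light members are exactly the members below the maximal
  light members, which are pairwise disjoint with `M ≤ √δ₀`; the packing bound (balanced two-group split + van den Berg–Kahn) gives `≤ √δ₀ + 2√δ₀`.
  Consequence: hierarchies / blob trees / chains / disjoint blocks never carry k-uniformly large small-pocket mass; a counterexample family to the
  crux must put its mass on CROSSING pockets.
* `sum_le_of_pairwiseDisjoint_of_le_pocketMass` — the packing bound for sub-masses `M_i ≤ m(U_i)`, `M_i ≤ B`: `Σ M_i ≤ B + 2√δ₀`.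
-/

noncomputable section

namespace Summit.CriticalPhenomena.PercolationContinuityZ3.Theorems

open MeasureTheory Set Literature.Probability.LatticeModels Literature.Probability.Percolation
open scoped Classical BigOperators

variable {n : ℕ}

/-- **Packing bound for sub-masses.**  If `U i` (`i ∈ s`) are pairwise relay-disjoint regions and `0 ≤ M i ≤ m(U i)` (the pocket mass of
`U i`, possibly negative) with `M i ≤ B`, `0 ≤ B`, then `Σ_{i∈s} M i ≤ B + 2·√P(o ↮ A)`. [this work] -/
theorem sum_le_of_pairwiseDisjoint_of_le_pocketMass {ι : Type*} (w : Sym2 (Fin n) → unitInterval) (A : Finset (Fin n)) (o : Fin n)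
    (U : ι → Finset (Fin n)) (M : ι → ℝ) (s : Finset ι) (B : ℝ) (hB0 : 0 ≤ B)
    (hdisj : ∀ i ∈ s, ∀ j ∈ s, i ≠ j → ∀ a ∈ A, a ∈ U i → a ∉ U j)
    (hMB : ∀ i ∈ s, M i ≤ B)
    (hMm : ∀ i ∈ s, M i ≤ (prodBernoulli w).real {ω : BondConfig (Fin n) | (∀ a ∈ A, a ∉ U i → ¬ (openGraph ω).Reachable o a) ∧
        ∃ a ∈ A, (openGraph ω).Reachable o a}) :
    ∑ i ∈ s, M i ≤ B + 2 * Real.sqrt ((prodBernoulli w).real {ω : BondConfig (Fin n) | ∀ a ∈ A, ¬ (openGraph ω).Reachable o a}) := by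
  classical
  set μ := prodBernoulli w with hμ
  set δ₀ : ℝ := μ.real {ω : BondConfig (Fin n) | ∀ a ∈ A, ¬ (openGraph ω).Reachable o a} with hδ₀
  set T : ℝ := ∑ i ∈ s, M i with hT
  have hsqrt0 : 0 ≤ Real.sqrt δ₀ := Real.sqrt_nonneg _
  by_cases hTB : T ≤ B
  · linarith
  have hTB' : B < T := lt_of_not_ge hTB
  set P : Finset (Finset ι) := s.powerset.filter (fun I => ∑ i ∈ I, M i ≤ (T + B) / 2) with hP
  have hPne : P.Nonempty := ⟨∅, by
    rw [hP, Finset.mem_filter]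
    refine ⟨Finset.empty_mem_powerset s, ?_⟩
    simp only [Finset.sum_empty]; linarith⟩
  obtain ⟨I, hIP, hImax⟩ := Finset.exists_max_image P (fun I => ∑ i ∈ I, M i) hPne
  rw [hP, Finset.mem_filter, Finset.mem_powerset] at hIP
  obtain ⟨hIs, hIle⟩ := hIP
  have hsplit : ∑ i ∈ I, M i + ∑ i ∈ s \ I, M i = T := by
    rw [hT, ← Finset.sum_union Finset.disjoint_sdiff, Finset.union_sdiff_of_subset hIs]
  have hIge : (T - B) / 2 ≤ ∑ i ∈ I, M i := by
    by_contra hlt0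
    have hlt : ∑ i ∈ I, M i < (T - B) / 2 := lt_of_not_ge hlt0
    have hpos : 0 < ∑ i ∈ s \ I, M i := by linarith
    obtain ⟨j, hj, hjpos⟩ : ∃ j ∈ s \ I, (0 : ℝ) < M j := by
      apply Finset.exists_lt_of_sum_lt
      simpa using hpos
    obtain ⟨hjs, hjI⟩ := Finset.mem_sdiff.1 hj
    have hins : insert j I ∈ P := by
      rw [hP, Finset.mem_filter, Finset.mem_powerset]
      refine ⟨Finset.insert_subset hjs hIs, ?_⟩
      rw [Finset.sum_insert hjI]
      have := hMB j hjs
      linarith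
    have := hImax (insert j I) hins
    rw [Finset.sum_insert hjI] at this
    linarith
  set U₁ : Finset (Fin n) := I.biUnion U with hU₁
  set U₂ : Finset (Fin n) := (s \ I).biUnion U with hU₂
  have hdisjI : ∀ i ∈ I, ∀ j ∈ I, i ≠ j → ∀ a ∈ A, a ∈ U i → a ∉ U j :=
    fun i hi j hj => hdisj i (hIs hi) j (hIs hj)
  have hdisjC : ∀ i ∈ s \ I, ∀ j ∈ s \ I, i ≠ j → ∀ a ∈ A, a ∈ U i → a ∉ U j :=
    fun i hi j hj => hdisj i (Finset.mem_sdiff.1 hi).1 j (Finset.mem_sdiff.1 hj).1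
  have h12 : ∀ a ∈ A, a ∈ U₁ → a ∉ U₂ := by
    intro a ha h1 h2
    obtain ⟨i, hi, hai⟩ := Finset.mem_biUnion.1 h1
    obtain ⟨j, hj, haj⟩ := Finset.mem_biUnion.1 h2
    obtain ⟨hjs, hjI⟩ := Finset.mem_sdiff.1 hj
    have hij : i ≠ j := fun h => hjI (h ▸ hi)
    exact hdisj i (hIs hi) j hjs hij a ha hai haj
  have hM1 : (T - B) / 2 ≤ μ.real {ω : BondConfig (Fin n) | (∀ a ∈ A, a ∉ U₁ → ¬ (openGraph ω).Reachable o a) ∧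
      ∃ a ∈ A, (openGraph ω).Reachable o a} :=
    (hIge.trans (Finset.sum_le_sum fun i hi => hMm i (hIs hi))).trans (pocketMass_biUnion_ge_sum w A o U I hdisjI)
  have hM2 : (T - B) / 2 ≤ μ.real {ω : BondConfig (Fin n) | (∀ a ∈ A, a ∉ U₂ → ¬ (openGraph ω).Reachable o a) ∧
      ∃ a ∈ A, (openGraph ω).Reachable o a} := by
    have hC : (T - B) / 2 ≤ ∑ i ∈ s \ I, M i := by linarith
    exact (hC.trans (Finset.sum_le_sum fun i hi => hMm i (Finset.mem_sdiff.1 hi).1)).trans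
      (pocketMass_biUnion_ge_sum w A o U (s \ I) hdisjC)
  have hvdbk := pocketDF_mul_le_of_disjoint w A U₁ U₂ o h12
  rw [pocketDF_eq_add_pocketMass w A U₁ o, pocketDF_eq_add_pocketMass w A U₂ o] at hvdbk
  have hgle : μ.real {ω : BondConfig (Fin n) | ∀ a ∈ A, a ∉ U₁ ∪ U₂ → ¬ (openGraph ω).Reachable o a} ≤ 1 :=
    measureReal_le_one
  have hδ₀0 : 0 ≤ δ₀ := measureReal_nonneg
  set x := μ.real {ω : BondConfig (Fin n) | (∀ a ∈ A, a ∉ U₁ → ¬ (openGraph ω).Reachable o a) ∧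
      ∃ a ∈ A, (openGraph ω).Reachable o a} with hx
  set y := μ.real {ω : BondConfig (Fin n) | (∀ a ∈ A, a ∉ U₂ → ¬ (openGraph ω).Reachable o a) ∧
      ∃ a ∈ A, (openGraph ω).Reachable o a} with hy
  have hx0 : 0 ≤ x := measureReal_nonneg
  have hy0 : 0 ≤ y := measureReal_nonneg
  have hTB2 : 0 ≤ (T - B) / 2 := by linarith
  have hprod : ((T - B) / 2) * ((T - B) / 2) ≤ δ₀ := by
    have h1 : ((T - B) / 2) * ((T - B) / 2) ≤ x * y := mul_le_mul hM1 hM2 hTB2 hx0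
    have h2 : x * y ≤ (δ₀ + x) * (δ₀ + y) := by nlinarith
    have h3 : (δ₀ + x) * (δ₀ + y) ≤
        μ.real {ω : BondConfig (Fin n) | ∀ a ∈ A, a ∉ U₁ ∪ U₂ → ¬ (openGraph ω).Reachable o a} * δ₀ := hvdbk
    have h4 : μ.real {ω : BondConfig (Fin n) | ∀ a ∈ A, a ∉ U₁ ∪ U₂ → ¬ (openGraph ω).Reachable o a} * δ₀ ≤ 1 * δ₀ :=
      mul_le_mul_of_nonneg_right hgle hδ₀0
    linarith
  have hle : (T - B) / 2 ≤ Real.sqrt δ₀ := by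
    rw [← Real.sqrt_mul_self hTB2]
    exact Real.sqrt_le_sqrt hprod
  linarith

/-- The `F`-mass below a region `U` is at most the pocket mass of `U`: for a family `F` of NONEMPTY relay sets,
`Σ_{T ∈ F, T ⊆ U} μ{π(o) = T} ≤ m(U)`. [folklore] -/
theorem laminar_subMass_le_pocketMass (w : Sym2 (Fin n) → unitInterval) (A : Finset (Fin n)) (o : Fin n)
    (F : Finset (Finset (Fin n))) (hFA : ∀ S ∈ F, S ⊆ A) (hne : ∀ S ∈ F, S.Nonempty) (U : Finset (Fin n)) :
    ∑ T ∈ F.filter (fun T => T ⊆ U), (prodBernoulli w).real {ω : BondConfig (Fin n) | (A.filter fun x => ω ∈ openConn o x) = T} ≤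
      (prodBernoulli w).real {ω : BondConfig (Fin n) | (∀ a ∈ A, a ∉ U → ¬ (openGraph ω).Reachable o a) ∧
        ∃ a ∈ A, (openGraph ω).Reachable o a} := by
  classical
  have hd : Set.PairwiseDisjoint (↑(F.filter (fun T => T ⊆ U)) : Set (Finset (Fin n)))
      (fun T => {ω : BondConfig (Fin n) | (A.filter fun x => ω ∈ openConn o x) = T}) := by
    intro S _ T _ hST
    refine Set.disjoint_left.2 fun ω h1 h2 => hST ?_
    simp only [Set.mem_setOf_eq] at h1 h2
    rw [← h1, ← h2]
  rw [← measureReal_biUnion_finset hd (fun i _ => MeasurableSet.of_discrete)]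
  refine measureReal_mono (fun ω hω => ?_) (measure_ne_top _ _)
  simp only [Set.mem_iUnion, Set.mem_setOf_eq, exists_prop, Finset.mem_filter] at hω ⊢
  obtain ⟨T, ⟨hTF, hTU⟩, hT⟩ := hω
  constructor
  · intro a ha haU hr
    have : a ∈ A.filter fun x => ω ∈ openConn o x := Finset.mem_filter.2 ⟨ha, hr⟩
    rw [hT] at this
    exact haU (hTU this)
  · obtain ⟨a, haT⟩ := hne T hTF
    have : a ∈ A.filter fun x => ω ∈ openConn o x := by rw [hT]; exact haT
    exact ⟨a, hFA T hTF haT, (Finset.mem_filter.1 this).2⟩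

/-- **THE LAMINAR THEOREM (k-uniform).**  For a laminar family `F` of nonempty proper subsets of the relay set `A` and `t` bounding every
pairwise disconnection probability `μ{a ↮ a'}` (`a ≠ a' ∈ A`):
`Σ_{S ∈ F} μ{π(o) = S} ≤ t + 3·√μ{o ↮ A}`.  [this work; LEAD-GEN5 §4] -/
theorem laminarPockets_sum_le (w : Sym2 (Fin n) → unitInterval) (A : Finset (Fin n)) (o : Fin n) (F : Finset (Finset (Fin n)))
    (hFA : ∀ S ∈ F, S ⊆ A) (hne : ∀ S ∈ F, S.Nonempty) (hproper : ∀ S ∈ F, S ≠ A)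
    (hlam : ∀ S ∈ F, ∀ T ∈ F, S ⊆ T ∨ T ⊆ S ∨ Disjoint S T)
    (t : ℝ) (ht0 : 0 ≤ t)
    (ht : ∀ a ∈ A, ∀ a' ∈ A, a ≠ a' → (prodBernoulli w).real {ω : BondConfig (Fin n) | ¬ (openGraph ω).Reachable a a'} ≤ t) :
    ∑ S ∈ F, (prodBernoulli w).real {ω : BondConfig (Fin n) | (A.filter fun x => ω ∈ openConn o x) = S} ≤
      t + 3 * Real.sqrt ((prodBernoulli w).real {ω : BondConfig (Fin n) | ∀ a ∈ A, ¬ (openGraph ω).Reachable o a}) := by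
  classical
  set μ := prodBernoulli w with hμ
  set δ₀ : ℝ := μ.real {ω : BondConfig (Fin n) | ∀ a ∈ A, ¬ (openGraph ω).Reachable o a} with hδ₀
  -- pocket law, subtree mass, pocket mass of a region
  set e : Finset (Fin n) → ℝ := fun S => μ.real {ω : BondConfig (Fin n) | (A.filter fun x => ω ∈ openConn o x) = S} with he
  set Ms : Finset (Fin n) → ℝ := fun S => ∑ T ∈ F.filter (fun T => T ⊆ S), e T with hMs
  set pm : Finset (Fin n) → ℝ := fun U => μ.real {ω : BondConfig (Fin n) | (∀ a ∈ A, a ∉ U → ¬ (openGraph ω).Reachable o a) ∧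
      ∃ a ∈ A, (openGraph ω).Reachable o a} with hpm
  have he0 : ∀ S, 0 ≤ e S := fun S => measureReal_nonneg
  have hMs0 : ∀ S, 0 ≤ Ms S := fun S => Finset.sum_nonneg fun T _ => he0 T
  have hMs_pm : ∀ U, Ms U ≤ pm U := fun U => laminar_subMass_le_pocketMass w A o F hFA hne U
  have hsqrt0 : 0 ≤ Real.sqrt δ₀ := Real.sqrt_nonneg _
  have hδ₀0 : 0 ≤ δ₀ := measureReal_nonneg
  -- monotonicity of the subtree mass
  have hMs_mono : ∀ S T, S ⊆ T → Ms S ≤ Ms T := by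
    intro S T hST
    apply Finset.sum_le_sum_of_subset_of_nonneg
    · intro X hX
      rw [Finset.mem_filter] at hX ⊢
      exact ⟨hX.1, hX.2.trans hST⟩
    · exact fun X _ _ => he0 X
  -- a member's own mass is part of its subtree mass
  have he_le_Ms : ∀ S ∈ F, e S ≤ Ms S := by
    intro S hS
    have hmem : S ∈ F.filter (fun T => T ⊆ S) := Finset.mem_filter.2 ⟨hS, subset_rfl⟩
    exact Finset.single_le_sum (f := e) (fun T _ => he0 T) hmem
  -- two DISJOINT members cannot both be heavy: `Ms S * Ms T ≤ δ₀`
  have hdisj_prod : ∀ S ∈ F, ∀ T ∈ F, Disjoint S T → Ms S * Ms T ≤ δ₀ := by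
    intro S hS T hT hST
    have h12 : ∀ a ∈ A, a ∈ S → a ∉ T := fun a _ haS haT => Finset.disjoint_left.1 hST haS haT
    have hv := pocketDF_mul_le_of_disjoint w A S T o h12
    rw [pocketDF_eq_add_pocketMass w A S o, pocketDF_eq_add_pocketMass w A T o] at hv
    have hgle : μ.real {ω : BondConfig (Fin n) | ∀ a ∈ A, a ∉ S ∪ T → ¬ (openGraph ω).Reachable o a} ≤ 1 := measureReal_le_one
    have h1 : Ms S * Ms T ≤ pm S * pm T := mul_le_mul (hMs_pm S) (hMs_pm T) (hMs0 T) (measureReal_nonneg)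
    have h2 : pm S * pm T ≤ (δ₀ + pm S) * (δ₀ + pm T) := by
      have := hMs0 S; have := hMs0 T
      have hpS : 0 ≤ pm S := measureReal_nonneg
      have hpT : 0 ≤ pm T := measureReal_nonneg
      nlinarith
    have h3 : (δ₀ + pm S) * (δ₀ + pm T) ≤
        μ.real {ω : BondConfig (Fin n) | ∀ a ∈ A, a ∉ S ∪ T → ¬ (openGraph ω).Reachable o a} * δ₀ := hv
    have h4 : μ.real {ω : BondConfig (Fin n) | ∀ a ∈ A, a ∉ S ∪ T → ¬ (openGraph ω).Reachable o a} * δ₀ ≤ 1 * δ₀ :=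
      mul_le_mul_of_nonneg_right hgle hδ₀0
    linarith
  -- HEAVY members (`Ms S > √δ₀`) are pairwise comparable
  set H : Finset (Finset (Fin n)) := F.filter (fun S => Real.sqrt δ₀ < Ms S) with hH
  have hH_comp : ∀ S ∈ H, ∀ T ∈ H, S ⊆ T ∨ T ⊆ S := by
    intro S hS T hT
    rw [hH, Finset.mem_filter] at hS hT
    rcases hlam S hS.1 T hT.1 with h | h | h
    · exact Or.inl h
    · exact Or.inr h
    · exfalso
      have hp := hdisj_prod S hS.1 T hT.1 h
      have : Real.sqrt δ₀ * Real.sqrt δ₀ < Ms S * Ms T :=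
        mul_lt_mul'' hS.2 hT.2 hsqrt0 hsqrt0
      rw [Real.mul_self_sqrt hδ₀0] at this
      linarith
  -- (1) the heavy chain is paid by one pair: `Σ_{S∈H} e S ≤ t`
  have hHeavy : ∑ S ∈ H, e S ≤ t := by
    rcases H.eq_empty_or_nonempty with hHe | hHne
    · rw [hHe, Finset.sum_empty]; exact ht0
    · -- smallest and largest heavy members by cardinality
      obtain ⟨S₀, hS₀, hmin⟩ := H.exists_min_image Finset.card hHne
      obtain ⟨S₁, hS₁, hmax⟩ := H.exists_max_image Finset.card hHne
      have hS₀sub : ∀ S ∈ H, S₀ ⊆ S := by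
        intro S hS
        rcases hH_comp S₀ hS₀ S hS with h | h
        · exact h
        · exact (Finset.eq_of_subset_of_card_le h (hmin S hS)).symm ▸ subset_rfl
      have hS₁sup : ∀ S ∈ H, S ⊆ S₁ := by
        intro S hS
        rcases hH_comp S hS S₁ hS₁ with h | h
        · exact h
        · exact (Finset.eq_of_subset_of_card_le h (hmax S hS)) ▸ subset_rfl
      have hS₀F : S₀ ∈ F := (Finset.mem_filter.1 hS₀).1
      have hS₁F : S₁ ∈ F := (Finset.mem_filter.1 hS₁).1
      obtain ⟨a, haS₀⟩ := hne S₀ hS₀F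
      have hS₁ne : S₁ ≠ A := hproper S₁ hS₁F
      have hS₁A : S₁ ⊆ A := hFA S₁ hS₁F
      obtain ⟨a', ha'A, ha'S₁⟩ : ∃ a' ∈ A, a' ∉ S₁ := by
        by_contra hcon
        exact hS₁ne (Finset.Subset.antisymm hS₁A fun x hx => by
          by_contra hx'
          exact hcon ⟨x, hx, hx'⟩)
      have haA : a ∈ A := hFA S₀ hS₀F haS₀
      have haa' : a ≠ a' := fun h => ha'S₁ (hS₁sup S₀ hS₀ (h ▸ haS₀))
      have hsum := sum_pocketEq_le_notConn w A o a a' (fun S : Finset (Fin n) => S) H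
        (fun i _ j _ hij => hij) (fun S hS => hS₀sub S hS haS₀) ha'A (fun S hS h => ha'S₁ (hS₁sup S hS h))
      exact hsum.trans (ht a haA a' ha'A haa')
  -- (2) maximal LIGHT members: pairwise disjoint, `Ms ≤ √δ₀`
  set Lt : Finset (Finset (Fin n)) := F.filter (fun S => Ms S ≤ Real.sqrt δ₀) with hLt
  set ML : Finset (Finset (Fin n)) := Lt.filter (fun L => ∀ T ∈ F, L ⊆ T → L ≠ T → Real.sqrt δ₀ < Ms T) with hML
  have hML_disj : ∀ L ∈ ML, ∀ L' ∈ ML, L ≠ L' → ∀ a ∈ A, a ∈ L → a ∉ L' := by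
    intro L hL L' hL' hLL' a _ haL haL'
    rw [hML, Finset.mem_filter, hLt, Finset.mem_filter] at hL hL'
    rcases hlam L hL.1.1 L' hL'.1.1 with h | h | h
    · exact absurd hL'.1.2 (not_le.2 (hL.2 L' hL'.1.1 h hLL'))
    · exact absurd hL.1.2 (not_le.2 (hL'.2 L hL.1.1 h (Ne.symm hLL')))
    · exact Finset.disjoint_left.1 h haL haL'
  have hLightPack : ∑ L ∈ ML, Ms L ≤ Real.sqrt δ₀ + 2 * Real.sqrt δ₀ := by
    refine sum_le_of_pairwiseDisjoint_of_le_pocketMass w A o (fun L : Finset (Fin n) => L) Ms ML (Real.sqrt δ₀) hsqrt0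
      hML_disj (fun L hL => ?_) (fun L _ => hMs_pm L)
    rw [hML, Finset.mem_filter, hLt, Finset.mem_filter] at hL
    exact hL.1.2
  -- (3) every light member lies below exactly one maximal light member; heavy members below none
  have hF_split : ∑ S ∈ F, e S = ∑ S ∈ H, e S + ∑ S ∈ Lt, e S := by
    rw [hH, hLt, ← Finset.sum_filter_add_sum_filter_not F (fun S => Real.sqrt δ₀ < Ms S)]
    congr 1
    apply Finset.sum_congr _ (fun _ _ => rfl)
    ext S; simp only [Finset.mem_filter, not_lt]
  -- existence of the maximal light member above a light member
  have hexists_max : ∀ S ∈ Lt, ∃ L ∈ ML, S ⊆ L := by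
    intro S hS
    set C : Finset (Finset (Fin n)) := Lt.filter (fun T => S ⊆ T) with hC
    have hCne : C.Nonempty := ⟨S, Finset.mem_filter.2 ⟨hS, subset_rfl⟩⟩
    obtain ⟨L, hLC, hLmax⟩ := C.exists_max_image Finset.card hCne
    rw [hC, Finset.mem_filter] at hLC
    refine ⟨L, ?_, hLC.2⟩
    rw [hML, Finset.mem_filter]
    refine ⟨hLC.1, fun T hT hLT hLT' => ?_⟩
    by_contra hle
    have hTLt : T ∈ Lt := by rw [hLt, Finset.mem_filter]; exact ⟨hT, not_lt.1 hle⟩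
    have hTC : T ∈ C := Finset.mem_filter.2 ⟨hTLt, hLC.2.trans hLT⟩
    have hcard := hLmax T hTC
    exact hLT' (Finset.eq_of_subset_of_card_le hLT hcard)
  -- uniqueness: two maximal light members above S coincide
  have hunique : ∀ S ∈ Lt, ∀ L ∈ ML, ∀ L' ∈ ML, S ⊆ L → S ⊆ L' → L = L' := by
    intro S hS L hL L' hL' hSL hSL'
    by_contra hLL'
    obtain ⟨a, haS⟩ := hne S (Finset.mem_filter.1 hS).1
    have haA : a ∈ A := hFA S (Finset.mem_filter.1 hS).1 haS
    exact hML_disj L hL L' hL' hLL' a haA (hSL haS) (hSL' haS)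
  have hLight : ∑ S ∈ Lt, e S ≤ ∑ L ∈ ML, Ms L := by
    -- Σ_{L∈ML} Ms L = Σ_{L∈ML} Σ_{T∈F, T⊆L} e T ≥ Σ_{S∈Lt} e S (each light S is counted under its unique maximal light member)
    have hge : ∀ L ∈ ML, ∑ S ∈ Lt.filter (fun S => S ⊆ L), e S ≤ Ms L := by
      intro L _
      apply Finset.sum_le_sum_of_subset_of_nonneg
      · intro S hS
        rw [Finset.mem_filter] at hS ⊢
        exact ⟨(Finset.mem_filter.1 hS.1).1, hS.2⟩
      · exact fun S _ _ => he0 S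
    have hcover : ∑ S ∈ Lt, e S = ∑ L ∈ ML, ∑ S ∈ Lt.filter (fun S => S ⊆ L), e S := by
      rw [← Finset.sum_biUnion]
      · apply Finset.sum_congr _ (fun _ _ => rfl)
        ext S
        simp only [Finset.mem_biUnion, Finset.mem_filter]
        constructor
        · intro hS
          obtain ⟨L, hL, hSL⟩ := hexists_max S hS
          exact ⟨L, hL, hS, hSL⟩
        · rintro ⟨L, _, hS, _⟩; exact hS
      · intro L hL L' hL' hLL'
        refine Finset.disjoint_left.2 fun S hS hS' => hLL' ?_
        rw [Finset.mem_filter] at hS hS'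
        exact hunique S hS.1 L hL L' hL' hS.2 hS'.2
    rw [hcover]
    exact Finset.sum_le_sum hge
  -- assemble
  calc ∑ S ∈ F, e S = ∑ S ∈ H, e S + ∑ S ∈ Lt, e S := hF_split
    _ ≤ t + (Real.sqrt δ₀ + 2 * Real.sqrt δ₀) := add_le_add hHeavy (hLight.trans hLightPack)
    _ = t + 3 * Real.sqrt δ₀ := by ring

end Summit.CriticalPhenomena.PercolationContinuityZ3.Theorems

end
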